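import Summits.PneNP.PneNP.Theses.SymmetryBudget
import Summits.PneNP.PneNP.Theorems.NPNotSubsetPPoly
import Summits.PneNP.PneNP.Theorems.HamCompiles.Negative.Irrefutable
import Summits.PneNP.PneNP.Theorems.HamCompiles.Negative.NonuniformCollapse
import Literature.Computability.Complexity.SymmetricCircuit
import Literature.Computability.Complexity.SymmetricDnf
import Literature.Combinatorics.SimpleGraph.HamiltonianCycleListings

/-!
# `HamCompiles` along the budget scale, and its P/poly form

Negative lemmas for crux `stmt-PneNP-10637` (`HamCompiles`, route `PneNP/SymmetryBudget`;
cdisprove seat `refuter-cdisprove-stmt-PneNP-10637-g2-0`, cycle 2; work file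
`Cruxes/HamCompiles/Disproof.lean` §9–§11). All statements are written over the landed vocabulary
(`HasSymCircuit`, `pointStabiliserBudget`), to which the route's inline `let`s unfold by `Iff.rfl`.

Write `HAM_m x := [fromRel (x · · = true) is Hamiltonian]`, `ConclAt g := ∃ p ∀ m, HasSymCircuit
tcBasis (Bud m (g m)) (p m) HAM_m`, `WindowHamAt g := ∀ p ∃ᶠ m ¬HasSymCircuit …`, so that
`HamCompiles = (NP ⊆ P → ConclAt ⌊log₂⌋)` and `WindowHam = WindowHamAt ⌊log₂⌋` definitionally.

* `windowHamAt_iff_not_conclAt`: `WindowHamAt g ↔ ¬ConclAt g` at EVERY budget `g` (padding by the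
  symmetric DNF of `Literature/…/SymmetricDnf.lean`); hence
  `not_hamCompilesAt_iff`: `¬(NP ⊆ P → ConclAt g) ↔ WindowHamAt g ∧ ¬PneNP`, and at the window
  `not_hamCompiles_iff_windowHam_and_not_pneNP`: a refutation of the crux is EXACTLY crux #2 plus
  `P = NP` — the crux is the bare transfer claim "crux #2 suffices for the summit".
* Budget monotonicity: `not_hamCompilesAt_mono` — the failure of the crux propagates UP the scale
  (more symmetry demanded = stronger claim); `not_hamCompilesAt_logSq_iff_not_pneNP`: at the
  over-budget `⌊log₂ m⌋²`, given the support item `PolylogHam` (printed theorem modulo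
  formalisation), failure of the compilation is exactly `P = NP` — that budget over-shoots to the
  summit; `conclAt_zero_iff_hamPolySize` / `not_hamCompilesAt_zero_iff`: budget `0` is the bare
  non-uniform bridge `NP ⊆ P → HAM ∈ SIZE^tc(poly)`, and its failure refutes the crux
  (`not_hamCompiles_of_not_hamCompilesAt_zero`).
* `conclAt_of_symmetrise`: below the window (`(g m)! ≤ poly`) the support item `Symmetrise` turns
  poly-size general `B2`-circuits for HAM into `ConclAt g` (kernel-checked plumbing; by
  `Negative/WindowArithmetic.lean` the same count is superpolynomial at `g = ⌊log₂ m⌋`).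
* P/poly form (`NP ⊆ P/poly → ConclAt ⌊log₂⌋`, what every proposed compilation line proves; it
  implies the crux by the bridge of `Negative/PPolyBridge.lean`): `ppolyForm_iff` — that form is
  EQUIVALENT to `WindowHam → NPNotSubsetPPoly`, so a landed line makes crux #2 at least the
  Karp–Lipton circuit lower bound (conjecture leaf `NPNotSubsetPPoly`).
-/

-- `Summit.PneNP.PneNP.…` duplicates `PneNP` BY DESIGN (single-problem summit, D-0017); the Summits
-- library sets this option globally (lakefile), repeated here so a standalone `lean check` is warning-free.
set_option linter.dupNamespace false

namespace Summit.PneNP.PneNP.Theorems.HamCompiles.Negative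

open Literature.Computability.Complexity
open Summit.PneNP.PneNP.Theses.SymmetryBudget (HamCompiles WindowHam PolylogHam Symmetrise)
open scoped Classical

/-! ### Invariance and per-`m` existence at every budget -/

/-- `HAM_m` is invariant under relabelling by any vertex permutation (`ρ` is a graph
isomorphism). -/
theorem ham_relabel_eq {m : ℕ} (ρ : Equiv.Perm (Fin m)) (x : Fin m × Fin m → Bool) :
    (fun x : Fin m × Fin m → Bool =>
          decide (SimpleGraph.fromRel fun u v => x (u, v) = true : SimpleGraph (Fin m)).IsHamiltonian)
        (fun q : Fin m × Fin m => x (ρ q.1, ρ q.2)) =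
      (fun x : Fin m × Fin m → Bool =>
          decide (SimpleGraph.fromRel fun u v => x (u, v) = true : SimpleGraph (Fin m)).IsHamiltonian) x :=
  decide_eq_decide.2
    (Literature.Combinatorics.SimpleGraph.isHamiltonian_iff_of_iso
      (⟨ρ, by intro a b; simp [SimpleGraph.fromRel_adj, ρ.injective.ne_iff]⟩ :
        (SimpleGraph.fromRel fun u v =>
            (fun q : Fin m × Fin m => x (ρ q.1, ρ q.2)) (u, v) = true : SimpleGraph (Fin m)) ≃g
          (SimpleGraph.fromRel fun u v => x (u, v) = true : SimpleGraph (Fin m))))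

/-- Per-`m` existence at EVERY budget: the symmetric DNF of `HAM_m` (exponential size). -/
theorem hasSym_ham_dnf (m g : ℕ) :
    HasSymCircuit tcBasis (pointStabiliserBudget m g) (2 ^ (m * m) + m * m + 1)
        (fun x : Fin m × Fin m → Bool =>
          decide (SimpleGraph.fromRel fun u v => x (u, v) = true : SimpleGraph (Fin m)).IsHamiltonian) :=
  hasSymCircuit_of_invariant _ _ fun ρ _ x => ham_relabel_eq ρ x

/-- Less budget = less symmetry demanded. -/
theorem hasSym_ham_budget_anti {m g g' s : ℕ} (h : g ≤ g')
    (hS : HasSymCircuit tcBasis (pointStabiliserBudget m g') s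
        (fun x : Fin m × Fin m → Bool =>
          decide (SimpleGraph.fromRel fun u v => x (u, v) = true : SimpleGraph (Fin m)).IsHamiltonian)) :
    HasSymCircuit tcBasis (pointStabiliserBudget m g) s
        (fun x : Fin m × Fin m → Bool =>
          decide (SimpleGraph.fromRel fun u v => x (u, v) = true : SimpleGraph (Fin m)).IsHamiltonian) := by
  obtain ⟨C, hB, hs, hΓ, hf⟩ := hS
  exact ⟨C, hB, hs, hΓ.mono (pointStabiliserBudget_mono m h), hf⟩

/-! ### `WindowHamAt g ↔ ¬ ConclAt g`, and the crux as the bare transfer claim -/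

/-- **At every budget `g`, crux #2 is exactly the negation of the hypothesis-free conclusion of
crux #3** (padding finitely many `m` by the symmetric DNF). -/
theorem windowHamAt_iff_not_conclAt (g : ℕ → ℕ) :
    (∀ p : Polynomial ℕ, ∃ᶠ m in Filter.atTop,
      ¬ HasSymCircuit tcBasis (pointStabiliserBudget m (g m)) (p.eval m)
        (fun x : Fin m × Fin m → Bool =>
          decide (SimpleGraph.fromRel fun u v => x (u, v) = true : SimpleGraph (Fin m)).IsHamiltonian)) ↔
    ¬ (∃ p : Polynomial ℕ, ∀ m : ℕ,
      HasSymCircuit tcBasis (pointStabiliserBudget m (g m)) (p.eval m)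
        (fun x : Fin m × Fin m → Bool =>
          decide (SimpleGraph.fromRel fun u v => x (u, v) = true : SimpleGraph (Fin m)).IsHamiltonian)) := by
  constructor
  · rintro hW ⟨p, hp⟩
    obtain ⟨m, hm⟩ := (hW p).exists
    exact hm (hp m)
  · intro h p
    rw [Filter.frequently_atTop]
    intro M
    obtain ⟨p', hpp', hsp'⟩ := exists_poly_cover p M (fun m => 2 ^ (m * m) + m * m + 1)
    have hex : ∃ m, ¬ HasSymCircuit tcBasis (pointStabiliserBudget m (g m)) (p'.eval m)
        (fun x : Fin m × Fin m → Bool =>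
          decide (SimpleGraph.fromRel fun u v => x (u, v) = true : SimpleGraph (Fin m)).IsHamiltonian) := by
      by_contra hall
      push Not at hall
      exact h ⟨p', hall⟩
    obtain ⟨m, hm⟩ := hex
    refine ⟨m, ?_, fun hms => hm (hms.mono (hpp' m))⟩
    by_contra hlt
    exact hm ((hasSym_ham_dnf m (g m)).mono (hsp' m (Nat.lt_of_not_le hlt)))

/-- **`¬HamCompilesAt g ↔ WindowHamAt g ∧ ¬PneNP`** at every budget: a refutation of the
compilation claim at ANY scale is crux #2 at that scale together with `P = NP`. -/
theorem not_hamCompilesAt_iff (g : ℕ → ℕ) :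
    ¬ (PNPWave0.NP Bool ⊆ PNPWave0.P Bool →
        (∃ p : Polynomial ℕ, ∀ m : ℕ,
      HasSymCircuit tcBasis (pointStabiliserBudget m (g m)) (p.eval m)
        (fun x : Fin m × Fin m → Bool =>
          decide (SimpleGraph.fromRel fun u v => x (u, v) = true : SimpleGraph (Fin m)).IsHamiltonian))) ↔
    ((∀ p : Polynomial ℕ, ∃ᶠ m in Filter.atTop,
      ¬ HasSymCircuit tcBasis (pointStabiliserBudget m (g m)) (p.eval m)
        (fun x : Fin m × Fin m → Bool =>
          decide (SimpleGraph.fromRel fun u v => x (u, v) = true : SimpleGraph (Fin m)).IsHamiltonian)) ∧ ¬ PneNP) := by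
  rw [windowHamAt_iff_not_conclAt, pneNP_iff_not_np_subset_p, Classical.not_imp, not_not, and_comm]

/-- At the window: **`¬HamCompiles ↔ WindowHam ∧ ¬PneNP`** — the crux is literally "crux #2
suffices for the summit", so its refutation is crux #2 plus `P = NP`. -/
theorem not_hamCompiles_iff_windowHam_and_not_pneNP : ¬ HamCompiles ↔ (WindowHam ∧ ¬ PneNP) :=
  not_hamCompilesAt_iff (Nat.log 2)

/-! ### Monotonicity in the budget -/

/-- Failure of the conclusion propagates UP the scale. -/
theorem not_conclAt_mono {g g' : ℕ → ℕ} (h : ∀ m, g m ≤ g' m)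
    (hc : ¬ (∃ p : Polynomial ℕ, ∀ m : ℕ,
      HasSymCircuit tcBasis (pointStabiliserBudget m (g m)) (p.eval m)
        (fun x : Fin m × Fin m → Bool =>
          decide (SimpleGraph.fromRel fun u v => x (u, v) = true : SimpleGraph (Fin m)).IsHamiltonian))) :
    ¬ (∃ p : Polynomial ℕ, ∀ m : ℕ,
      HasSymCircuit tcBasis (pointStabiliserBudget m (g' m)) (p.eval m)
        (fun x : Fin m × Fin m → Bool =>
          decide (SimpleGraph.fromRel fun u v => x (u, v) = true : SimpleGraph (Fin m)).IsHamiltonian)) := by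
  rintro ⟨p, hp⟩
  exact hc ⟨p, fun m => hasSym_ham_budget_anti (h m) (hp m)⟩

/-- Crux #2 is monotone in the budget. -/
theorem windowHamAt_mono {g g' : ℕ → ℕ} (h : ∀ m, g m ≤ g' m)
    (hW : (∀ p : Polynomial ℕ, ∃ᶠ m in Filter.atTop,
      ¬ HasSymCircuit tcBasis (pointStabiliserBudget m (g m)) (p.eval m)
        (fun x : Fin m × Fin m → Bool =>
          decide (SimpleGraph.fromRel fun u v => x (u, v) = true : SimpleGraph (Fin m)).IsHamiltonian))) :
    (∀ p : Polynomial ℕ, ∃ᶠ m in Filter.atTop,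
      ¬ HasSymCircuit tcBasis (pointStabiliserBudget m (g' m)) (p.eval m)
        (fun x : Fin m × Fin m → Bool =>
          decide (SimpleGraph.fromRel fun u v => x (u, v) = true : SimpleGraph (Fin m)).IsHamiltonian)) :=
  fun p => (hW p).mono fun m hm hS => hm (hasSym_ham_budget_anti (h m) hS)

/-- **Failure of the crux propagates UP the scale**: more symmetry demanded of the compiled
circuit is a stronger claim. -/
theorem not_hamCompilesAt_mono {g g' : ℕ → ℕ} (h : ∀ m, g m ≤ g' m)
    (hc : ¬ (PNPWave0.NP Bool ⊆ PNPWave0.P Bool →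
        (∃ p : Polynomial ℕ, ∀ m : ℕ,
      HasSymCircuit tcBasis (pointStabiliserBudget m (g m)) (p.eval m)
        (fun x : Fin m × Fin m → Bool =>
          decide (SimpleGraph.fromRel fun u v => x (u, v) = true : SimpleGraph (Fin m)).IsHamiltonian)))) :
    ¬ (PNPWave0.NP Bool ⊆ PNPWave0.P Bool →
        (∃ p : Polynomial ℕ, ∀ m : ℕ,
      HasSymCircuit tcBasis (pointStabiliserBudget m (g' m)) (p.eval m)
        (fun x : Fin m × Fin m → Bool =>
          decide (SimpleGraph.fromRel fun u v => x (u, v) = true : SimpleGraph (Fin m)).IsHamiltonian))) := by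
  rw [Classical.not_imp] at hc ⊢
  exact ⟨hc.1, not_conclAt_mono h hc.2⟩

/-- In particular a refutation of the crux refutes the over-budget claim at `⌊log₂ m⌋²`. -/
theorem not_hamCompilesAt_logSq_of_not_hamCompiles (hc : ¬ HamCompiles) :
    ¬ (PNPWave0.NP Bool ⊆ PNPWave0.P Bool →
        (∃ p : Polynomial ℕ, ∀ m : ℕ,
      HasSymCircuit tcBasis (pointStabiliserBudget m (Nat.log 2 m ^ 2)) (p.eval m)
        (fun x : Fin m × Fin m → Bool =>
          decide (SimpleGraph.fromRel fun u v => x (u, v) = true : SimpleGraph (Fin m)).IsHamiltonian))) :=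
  not_hamCompilesAt_mono (fun m => Nat.le_self_pow two_ne_zero (Nat.log 2 m)) hc

/-- **Over-budget = summit.** Given the support item `PolylogHam` (crux #2 at budget `⌊log₂ m⌋²`,
a printed theorem modulo formalisation), the failure of the compilation claim at that budget is
EXACTLY `P = NP`: demanding polylog symmetry over-shoots to the summit itself. -/
theorem not_hamCompilesAt_logSq_iff_not_pneNP (hPH : PolylogHam) :
    ¬ (PNPWave0.NP Bool ⊆ PNPWave0.P Bool →
        (∃ p : Polynomial ℕ, ∀ m : ℕ,
      HasSymCircuit tcBasis (pointStabiliserBudget m (Nat.log 2 m ^ 2)) (p.eval m)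
        (fun x : Fin m × Fin m → Bool =>
          decide (SimpleGraph.fromRel fun u v => x (u, v) = true : SimpleGraph (Fin m)).IsHamiltonian))) ↔ ¬ PneNP := by
  rw [not_hamCompilesAt_iff (fun m => Nat.log 2 m ^ 2)]
  exact ⟨And.right, fun h => ⟨hPH, h⟩⟩

/-! ### Budget `0`: the bare non-uniform bridge -/

/-- At budget `0` (no symmetry demanded) the conclusion is plain poly-size. -/
theorem conclAt_zero_iff_hamPolySize :
    (∃ p : Polynomial ℕ, ∀ m : ℕ,
      HasSymCircuit tcBasis (pointStabiliserBudget m 0) (p.eval m)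
        (fun x : Fin m × Fin m → Bool =>
          decide (SimpleGraph.fromRel fun u v => x (u, v) = true : SimpleGraph (Fin m)).IsHamiltonian)) ↔
    (∃ p : Polynomial ℕ, ∀ m : ℕ, ∃ C : Circuit (Fin m × Fin m),
      C.IsOver tcBasis ∧ C.size ≤ p.eval m ∧ C.Computes
        (fun x : Fin m × Fin m → Bool =>
          decide (SimpleGraph.fromRel fun u v => x (u, v) = true : SimpleGraph (Fin m)).IsHamiltonian)) := by
  constructor
  · rintro ⟨p, hp⟩
    refine ⟨p, fun m => ?_⟩
    obtain ⟨C, hB, hs, -, hf⟩ := hp m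
    exact ⟨C, hB, hs, hf⟩
  · rintro ⟨p, hp⟩
    refine ⟨p, fun m => ?_⟩
    obtain ⟨C, hB, hs, hf⟩ := hp m
    refine ⟨C, hB, hs, ?_, hf⟩
    rw [pointStabiliserBudget_zero]
    exact Circuit.isSymmetricUnder_one C

/-- So the failure of the budget-`0` claim is `NP ⊆ P` with `HAM ∉ SIZE^tc(poly)` (which would
itself prove `P ≠ NP` through `P ⊆ P/poly`: the budget-`0` claim is theorem-level). -/
theorem not_hamCompilesAt_zero_iff :
    ¬ (PNPWave0.NP Bool ⊆ PNPWave0.P Bool →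
        (∃ p : Polynomial ℕ, ∀ m : ℕ,
      HasSymCircuit tcBasis (pointStabiliserBudget m 0) (p.eval m)
        (fun x : Fin m × Fin m → Bool =>
          decide (SimpleGraph.fromRel fun u v => x (u, v) = true : SimpleGraph (Fin m)).IsHamiltonian))) ↔
    (PNPWave0.NP Bool ⊆ PNPWave0.P Bool ∧
      ¬ (∃ p : Polynomial ℕ, ∀ m : ℕ, ∃ C : Circuit (Fin m × Fin m),
      C.IsOver tcBasis ∧ C.size ≤ p.eval m ∧ C.Computes
        (fun x : Fin m × Fin m → Bool =>
          decide (SimpleGraph.fromRel fun u v => x (u, v) = true : SimpleGraph (Fin m)).IsHamiltonian))) := by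
  rw [conclAt_zero_iff_hamPolySize, Classical.not_imp]

/-- … and it refutes the crux (the sandwich `HamCompilesAt log² → HamCompiles → HamCompilesAt 0`
read negatively). -/
theorem not_hamCompiles_of_not_hamCompilesAt_zero
    (h : ¬ (PNPWave0.NP Bool ⊆ PNPWave0.P Bool →
        (∃ p : Polynomial ℕ, ∀ m : ℕ,
      HasSymCircuit tcBasis (pointStabiliserBudget m 0) (p.eval m)
        (fun x : Fin m × Fin m → Bool =>
          decide (SimpleGraph.fromRel fun u v => x (u, v) = true : SimpleGraph (Fin m)).IsHamiltonian)))) : ¬ HamCompiles :=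
  not_hamCompilesAt_mono (fun _ => Nat.zero_le _) h

/-! ### Below the window: `Symmetrise` compiles -/

/-- **Bridge edge.** For a budget `g` with `(g m)! ≤ r m` (`r` a polynomial; e.g.
`g = O(log m / log log m)`), the support item `Symmetrise` turns poly-size general `B2`-circuits
for HAM into poly-size Bud(m, g m)-symmetric threshold circuits at every `m`. -/
theorem conclAt_of_symmetrise (hS : Symmetrise) {g : ℕ → ℕ} (r : Polynomial ℕ)
    (hg : ∀ m, Nat.factorial (g m) ≤ r.eval m)
    (hH : (∃ p : Polynomial ℕ, ∀ m : ℕ, ∃ C : Circuit (Fin m × Fin m),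
      C.IsOver B2 ∧ C.size ≤ p.eval m ∧ C.Computes
        (fun x : Fin m × Fin m → Bool =>
          decide (SimpleGraph.fromRel fun u v => x (u, v) = true : SimpleGraph (Fin m)).IsHamiltonian))) :
    (∃ p : Polynomial ℕ, ∀ m : ℕ,
      HasSymCircuit tcBasis (pointStabiliserBudget m (g m)) (p.eval m)
        (fun x : Fin m × Fin m → Bool =>
          decide (SimpleGraph.fromRel fun u v => x (u, v) = true : SimpleGraph (Fin m)).IsHamiltonian)) := by
  obtain ⟨c, hc⟩ := (show ∃ c : ℕ, ∀ (m g : ℕ) (f : (Fin m × Fin m → Bool) → Bool),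
      (∀ ρ ∈ pointStabiliserBudget m g, ∀ x : Fin m × Fin m → Bool,
          f (fun q : Fin m × Fin m => x (ρ q.1, ρ q.2)) = f x) →
        ∀ C : Circuit (Fin m × Fin m), C.IsOver B2 → C.Computes f →
          HasSymCircuit tcBasis (pointStabiliserBudget m g)
            (c * (Nat.factorial g * (C.size + 1))) f from hS)
  obtain ⟨p, hp⟩ := hH
  refine ⟨Polynomial.C c * (r * (p + 1)), fun m => ?_⟩
  obtain ⟨C, hB, hs, hf⟩ := hp m
  refine (hc m (g m) _ (fun ρ _ x => ham_relabel_eq ρ x) C hB hf).mono ?_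
  simp only [Polynomial.eval_mul, Polynomial.eval_C, Polynomial.eval_add, Polynomial.eval_one]
  exact Nat.mul_le_mul_left _ (Nat.mul_le_mul (hg m) (Nat.succ_le_succ hs))

/-! ### The P/poly form (pure logic half; the bridge `NP ⊆ P → NP ⊆ P/poly` is in `PPolyBridge.lean`) -/

/-- **The P/poly form is EQUIVALENT to `WindowHam → NPNotSubsetPPoly`**: a landed line makes
crux #2 at least the Karp–Lipton circuit lower bound. -/
theorem ppolyForm_iff :
    ((Nondeterministic.NP ⊆ PPoly) →
        (∃ p : Polynomial ℕ, ∀ m : ℕ,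
      HasSymCircuit tcBasis (pointStabiliserBudget m (Nat.log 2 m)) (p.eval m)
        (fun x : Fin m × Fin m → Bool =>
          decide (SimpleGraph.fromRel fun u v => x (u, v) = true : SimpleGraph (Fin m)).IsHamiltonian))) ↔
    (WindowHam → NPNotSubsetPPoly) := by
  have hW := windowHamAt_iff_not_conclAt (Nat.log 2)
  constructor
  · intro h hWin hsub
    exact (hW.1 hWin) (h hsub)
  · intro h hsub
    by_contra hc
    exact h (hW.2 hc) hsub

end Summit.PneNP.PneNP.Theorems.HamCompiles.Negative
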